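import Literature.NumberTheory.EllipticCurves.SelmerTorsionRestriction
import Literature.NumberTheory.EllipticCurves.KummerMap
import Literature.NumberTheory.EllipticCurves.PeriodIndexCorestrictionLocal
import Literature.NumberTheory.EllipticCurves.SelmerGaloisAction
import Literature.NumberTheory.EllipticCurves.VariableChangePointsMap
import HarnessLib

/-!
# Route ByReductionTypeAtTwo, crux `RankOneAtTwoBigImageOddLocal` (stmt-BirchSwinnertonDyer-23715), LINE v8.9 `one_door_analytic`:
# the Kummer map commutes with restriction — `res_{L/K} (κ_K P) = κ_L (P_L)`

Lead prover seat `bsd-line-fkl-p1` g12 (2026-08-28), `--supports stmt-BirchSwinnertonDyer-23715` (helper).  THEOREMS ONLY; no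
definition, no named fact introduced, no `sorry`; BSD is not proved by any of this.

Why.  The field `y` of `FirstDescentInput W Wd` (`Theorems/…OneDoorFirstDescentDefs.lean`) is the Kummer class over `ℚ` of a rational
point (`y = κ_ℚ(g)`, `g` a generator of `E(ℚ)` modulo torsion), while Gross's Prop. 6.2 (2) — the fields `c₁_loc_iff`, `c₂_loc_iff`, via
route GenusKolyvaginAtTwo's item 24880 — reads the Heegner point through its Kummer class OVER `K`.  The bridge is the naturality of the
Kummer map under restriction, `resTorsion W L n (kummerMapTorsion W n _ P) = kummerMapTorsion (W.baseChange L) n _ (P_L)`, which the tree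
did not have (`Rubin1987`-style consumers take it as a hypothesis).  Proved here at the cocycle level:

* §1 `resTorsion_kummerClassTorsion` — for `Q ∈ E(K̄)` with `n • Q` fixed by `Γ_K`: `res [σ ↦ σQ − Q] = [g ↦ gQ' − Q']` with `Q'` the
  image of `Q` in `E_L(L̄)` (`resH1Hom_oneCocycleClass` + the compatible pair `(resGal L, torsionBaseChangeMap)`);
* §2 `localPointsEquivGeomPoints_pointsMap_toGeomPoints` — the coefficient map sends the geometric point of `P ∈ E(K)` to the geometric
  point of `P_L ∈ E(L)` (coordinates: `closureEmb ∘ algebraMap K K̄ = algebraMap L L̄ ∘ algebraMap K L`);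
  `resTorsion_kummerMapTorsion` — **`res (κ_K P) = κ_L (P_L)`** (any roots: `kummerMapTorsionFun_eq`).

References: [SilvermanAEC2009] VIII.§2 (the Kummer pairing is functorial), X.§4; [SerreGaloisCohomology1997] I.§2.4 (compatible pairs).
-/

set_option autoImplicit false
-- the Theorems namespace of this sub repeats the summit name by design (D-0017 nested layout)
set_option linter.dupNamespace false

noncomputable section

open scoped Classical

universe u

namespace Summit.BirchSwinnertonDyer.BirchSwinnertonDyer.Theorems.RankOneAtTwoOneDoor

open WeierstrassCurve Literature.NumberTheory.EllipticCurves Literature.NumberTheory.GaloisRepresentations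

variable {K : Type u} [Field K] (W : WeierstrassCurve K) (L : Type u) [Field L] [Algebra K L] (n : ℤ)

/-! ### §1 Restriction of a Kummer class is the Kummer class of the transported point -/

/-- `n • Q'` is `Γ_L`-fixed when `n • Q` is `Γ_K`-fixed, `Q'` the image of `Q ∈ E(K̄)` in `E_L(L̄)` (`Γ_L` acts through `resGal L`).
[cite: SerreGaloisCohomology1997, I.§2.4] -/
theorem zsmul_localPointsEquivGeomPoints_pointsMap_mem_fixedPoints (Q : geomPoints W)
    (hQ : n • Q ∈ MulAction.fixedPoints (Field.absoluteGaloisGroup K) (geomPoints W)) :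
    n • localPointsEquivGeomPoints W L (pointsMap W L Q) ∈
      MulAction.fixedPoints (Field.absoluteGaloisGroup L) (geomPoints (W.baseChange L)) := by
  intro σ
  rw [← map_zsmul, ← map_zsmul, ← localPointsEquivGeomPoints_smul, ← pointsMap_smul, hQ (resGal (K := K) L σ)]

/-- **`res (κ Q) = κ Q'`**: the restriction `H¹(K, E[n]) → H¹(L, E_L[n])` (`resTorsion`) sends the Kummer class `[σ ↦ σQ − Q]` of a point
`Q ∈ E(K̄)` with `n • Q ∈ E(K̄)^{Γ_K}` to the Kummer class of its image `Q' ∈ E_L(L̄)` — the pulled-back cocycle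
`g ↦ ι((resGal g)Q − Q)` IS `g ↦ gQ' − Q'` (`pointsMap_smul`). [cite: SilvermanAEC2009, VIII.§2] [cite: SerreGaloisCohomology1997, I.§2.4] -/
theorem resTorsion_kummerClassTorsion (Q : geomPoints W)
    (hQ : n • Q ∈ MulAction.fixedPoints (Field.absoluteGaloisGroup K) (geomPoints W)) :
    resTorsion W L n (kummerClassTorsion W n Q hQ) =
      kummerClassTorsion (W.baseChange L) n (localPointsEquivGeomPoints W L (pointsMap W L Q))
        (zsmul_localPointsEquivGeomPoints_pointsMap_mem_fixedPoints W L n Q hQ) := by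
  unfold resTorsion kummerClassTorsion
  rw [resH1Hom_oneCocycleClass]
  congr 1
  apply Subtype.ext
  ext g : 1
  apply Subtype.ext
  rw [contOneCocycles.pullback_apply]
  change (torsionBaseChangeMap W L n ((kummerCocycleTorsion W n Q hQ).1 (resGal (K := K) L g)) :
      geomPoints (W.baseChange L)) =
    g • localPointsEquivGeomPoints W L (pointsMap W L Q) - localPointsEquivGeomPoints W L (pointsMap W L Q)
  rw [coe_torsionBaseChangeMap, coe_kummerCocycleTorsion_apply, map_sub, map_sub, pointsMap_smul,
    localPointsEquivGeomPoints_smul]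

/-! ### §2 Rational points: `res (κ_K P) = κ_L (P_L)` -/

/-- **The coefficient map on a rational point**: `E(K̄) → E_L(L̄)` (the chosen embedding on coordinates, then the identification of
coefficients) sends the geometric point of `P ∈ E(K)` to the geometric point of its image `P_L ∈ E(L)`
(`closureEmb ∘ algebraMap K K̄ = algebraMap K L̄ = algebraMap L L̄ ∘ algebraMap K L`). [folklore] -/
theorem localPointsEquivGeomPoints_pointsMap_toGeomPoints (P : W.toAffine.Point) :
    localPointsEquivGeomPoints W L (pointsMap W L (toGeomPoints W P)) =
      toGeomPoints (W.baseChange L) (Affine.Point.map (W' := W) (Algebra.ofId K L) P) := by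
  rcases P with _ | ⟨x, y, h⟩
  · rfl
  · obtain ⟨h₁, e₁⟩ : ∃ h₁, pointsMap W L (toGeomPoints W (.some x y h)) =
        (Affine.Point.some (closureEmb (K := K) L (algebraMap K (AlgebraicClosure K) x))
          (closureEmb (K := K) L (algebraMap K (AlgebraicClosure K) y)) h₁ : localPoints W L) := ⟨_, rfl⟩
    obtain ⟨h₂, e₂⟩ : ∃ h₂, localPointsEquivGeomPoints W L (pointsMap W L (toGeomPoints W (.some x y h))) =
        Affine.Point.some (closureEmb (K := K) L (algebraMap K (AlgebraicClosure K) x))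
          (closureEmb (K := K) L (algebraMap K (AlgebraicClosure K) y)) h₂ := by
      rw [e₁]
      simp only [localPointsEquivGeomPoints, pointsCongr]
      refine ⟨?w, ?e⟩
      case e => exact Affine.Point.congrEquiv_some _ h₁
      case w => exact (baseChange_baseChange W L (AlgebraicClosure L)).symm ▸ h₁
    rw [e₂]
    have hx : closureEmb (K := K) L (algebraMap K (AlgebraicClosure K) x) =
        algebraMap L (AlgebraicClosure L) (algebraMap K L x) := by
      rw [AlgHom.commutes, IsScalarTower.algebraMap_apply K L (AlgebraicClosure L)]
    have hy : closureEmb (K := K) L (algebraMap K (AlgebraicClosure K) y) =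
        algebraMap L (AlgebraicClosure L) (algebraMap K L y) := by
      rw [AlgHom.commutes, IsScalarTower.algebraMap_apply K L (AlgebraicClosure L)]
    exact Affine.Point.some_eq_some_of_eq hx hy

/-- **The Kummer map commutes with restriction: `res_{L/K} (κ_K P) = κ_L (P_L)`** for `P ∈ E(K)`, `P_L` its image in `E(L)`, any level
`n` and any choices of `n`-division points (`hdivK`, `hdivL`): the Kummer class does not depend on the root (`kummerMapTorsionFun_eq`), and a
root of `P` maps to a root of `P_L` (§1, `localPointsEquivGeomPoints_pointsMap_toGeomPoints`). [cite: SilvermanAEC2009, VIII.§2]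
[cite: SerreGaloisCohomology1997, I.§2.4] -/
theorem resTorsion_kummerMapTorsion (hdivK : ∀ P : geomPoints W, ∃ Q : geomPoints W, n • Q = P)
    (hdivL : ∀ P : geomPoints (W.baseChange L), ∃ Q : geomPoints (W.baseChange L), n • Q = P) (P : W.toAffine.Point) :
    resTorsion W L n (kummerMapTorsion W n hdivK P) =
      kummerMapTorsion (W.baseChange L) n hdivL (Affine.Point.map (W' := W) (Algebra.ofId K L) P) := by
  rw [kummerMapTorsion_apply, kummerMapTorsion_apply,
    kummerMapTorsionFun_eq (W.baseChange L) n hdivL _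
      (localPointsEquivGeomPoints W L (pointsMap W L (zsmulRoot W n hdivK P))) ?_]
  · exact resTorsion_kummerClassTorsion W L n _ _
  · rw [← map_zsmul, ← map_zsmul, zsmul_zsmulRoot, localPointsEquivGeomPoints_pointsMap_toGeomPoints]

end Summit.BirchSwinnertonDyer.BirchSwinnertonDyer.Theorems.RankOneAtTwoOneDoor

end
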